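import Literature.AlgebraicGeometry.Frobenioids.ArchimedeanNotIsoSubanchorC
import Literature.AlgebraicGeometry.Frobenioids.ArchimedeanSlitMorphisms
import HarnessLib

/-!
# Frobenioids II, Proposition 3.5 (iv) «`A` is not of RC-iso-subanchor type» — PROVED for the ANGULAR
# Frobenioid `A ⊆ C` (isometries) under Example 3.3's standing hypotheses on `D`

Mochizuki, *The geometry of Frobenioids II*, Kyushu J. Math. **62** (2008) 401–460, §3, Prop. 3.5 (iv),
kurims text p. 34 [cite: MochizukiFrdII2008, Prop 3.5 (iv) p.34]: "`F` is not of RC-iso-subanchor type"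
for `F` "one of the categories `C`, `A`". The companion file `ArchimedeanNotIsoSubanchorC.lean` proves the
case `F = C`; this file transports the argument to `F = A`, the wide subcategory of isometries: the hull
arrow `B → B^istr`, its universal arrow towards isotropic objects, the induced automorphisms
(abc-iut-L1-t9's `A.istrEndo`) and the prime-degree Frobenius-type arrows `((id, p, 1), id) : X → X^{(p)}`
are all ISOMETRIES, factorizations in `A` are factorizations in `C`, and an arrow of `A` invertible in `C`
is invertible in `A` (inverses of isometric isomorphisms of `C₀` are isometries,
`C0.isIsometry_inv`). Result: `prop35iv_A : IsGraphConnected D → IsTotallyEpimorphic D → Prop35iv_A π`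
(the instance `Prop35iv_A` of `ArchimedeanTheoremsInstances.lean` under the two standing hypotheses of
Ex. 3.3 on `D`; cf. finding P35iv-F1 for the bare instance at `D = ∅`).
Everything is PROVED; no statement of the paper is strengthened; nothing here bears on [IUTchIII].
-/

namespace Literature.AlgebraicGeometry.Frobenioids

open CategoryTheory
open scoped Pointwise

noncomputable section

universe v u

namespace ArchFrd

variable {D : Type u} [Category.{v} D] (π : D ⥤ D0)

/-- In a full subcategory, an arrow whose underlying arrow is an isomorphism is an isomorphism. [folklore] -/
private theorem isIso_of_isIso_hom' {T : Type u} [Category.{v} T] {P : ObjectProperty T}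
    {A B : P.FullSubcategory} (f : A ⟶ B) [IsIso f.hom] : IsIso f :=
  ⟨⟨ObjectProperty.homMk (inv f.hom), ObjectProperty.hom_ext _ (IsIso.hom_inv_id f.hom),
    ObjectProperty.hom_ext _ (IsIso.inv_hom_id f.hom)⟩⟩

namespace A

/-! ### Isomorphisms of `A` from isomorphisms of `C` -/

/-- An arrow of `A` that is invertible in `C` is invertible in `A` (the inverse of an isometric
isomorphism is an isometry). [cite: MochizukiFrdII2008, Ex 3.3 (iii) p.29] -/
theorem isIso_of_isIso_val {X Y : A π} (φ : X ⟶ Y) [IsIso φ.1] : IsIso φ := by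
  haveI : IsIso φ.1.fst := CFP.isIso_fst φ.1
  have h : PreFrobenioid.IsIsometry (C.toElem π) (inv φ.1) := by
    have h1 : (inv φ.1).fst = inv φ.1.fst := (C.toC0 π).map_inv φ.1
    have h2 : PreFrobenioid.IsIsometry C0.toElem (inv φ.1).fst := by
      rw [h1]; exact C0.isIsometry_inv φ.1.fst
    exact h2
  exact ⟨⟨⟨inv φ.1, h⟩, WideSubcategory.hom_ext _ (IsIso.hom_inv_id φ.1),
    WideSubcategory.hom_ext _ (IsIso.inv_hom_id φ.1)⟩⟩

/-! ### Frobenius-type arrows of `A` -/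

/-- The Frobenius-type arrows `X → X^{(n)}` are isometries (`|1| · tip^n = tip^n`).
[cite: MochizukiFrdII2008, Ex 3.3 (iii) p.29] -/
theorem isIsometry_frobHom (X : C π) (n : ℕ+) : PreFrobenioid.IsIsometry (C.toElem π) (ArchFrd.frobHom π X n) := by
  have h : PreFrobenioid.IsIsometry C0.toElem (ArchFrd.frobHom π X n).fst := by
    rw [A0.isIsometry_iff_norm_mul_tip_pow]
    change ‖((1 : ℂˣ) : ℂ)‖ * X.fst.tip ^ ((n : ℕ+) : ℕ) = (frobObj π X n).fst.tip
    rw [Units.val_one, norm_one, one_mul, tip_frobObj]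
  exact h

/-- The Frobenius-type arrow `((id, n, 1), id) : X → X^{(n)}` in `A`. [cite: MochizukiFrdII2008, Ex 3.3 (iii) p.29] -/
def frobHom (X : A π) (n : ℕ+) : X ⟶ (⟨frobObj π X.obj n⟩ : A π) :=
  ⟨ArchFrd.frobHom π X.obj n, isIsometry_frobHom π X.obj n⟩

/-- **Irreducibility in `A`** of the prime-degree Frobenius-type arrows out of objects with naively
isotropic region (`D` totally epimorphic): factorizations in `A` are factorizations in `C`.
[cite: MochizukiFrdII2008, Prop 3.5 (iv) p.34] -/
theorem isIrreducibleHom_frobHom (hTE : IsTotallyEpimorphic D) (X : A π) (hX : X.obj.fst.IsNaivelyIsotropic)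
    (p : ℕ+) (hp : (p : ℕ).Prime) : IsIrreducibleHom (frobHom π X p) := by
  refine ⟨fun hi => ?_, fun W β α h => ?_⟩
  · haveI := hi
    haveI : IsIso ((A.ι π).map (frobHom π X p)) := inferInstance
    exact not_isIso_frobHom π X.obj p (fun h1 => hp.ne_one (by rw [h1]; rfl))
      (this : IsIso (ArchFrd.frobHom π X.obj p))
  · have h' : β.1 ≫ α.1 = ArchFrd.frobHom π X.obj p := congrArg (fun k => k.1) h
    rcases isIso_or_isIso_of_fac_frobHom π hTE hX p hp β.1 α.1 h' with hα | hβ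
    · haveI := hα; exact Or.inl (isIso_of_isIso_val π α)
    · haveI := hβ; exact Or.inr (isIso_of_isIso_val π β)

/-! ### `A[ℂ]` and anchors -/

/-- The functor `A → D → D₀ → ArchBase` along which "real/complex" is read. [cite: MochizukiFrdII2008, Def 3.1 (v) p.24] -/
abbrev rcOf : A π ⥤ ArchBase := PreFrobenioid.baseFunctor (A.toElem π) ⋙ baseRC π

/-- The Frobenius-type arrow inside `A[ℂ]`. [cite: MochizukiFrdII2008, Prop 3.5 (iv) p.34] -/
def frobHomC (X : A π) (hc : RC.complexObjects (rcOf π) X) (p : ℕ+) :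
    (⟨X, hc⟩ : RC.ComplexPart (rcOf π)) ⟶ ⟨⟨frobObj π X.obj p⟩, hc⟩ :=
  ObjectProperty.homMk (frobHom π X p)

/-- Irreducibility inside `A[ℂ]`. [cite: MochizukiFrdII2008, Prop 3.5 (iv) p.34] -/
theorem isIrreducibleHom_frobHomC (hTE : IsTotallyEpimorphic D) (X : A π) (hc : RC.complexObjects (rcOf π) X)
    (hX : X.obj.fst.IsNaivelyIsotropic) (p : ℕ+) (hp : (p : ℕ).Prime) :
    IsIrreducibleHom (frobHomC π X hc p) := by
  refine ⟨fun hi => ?_, fun W β α h => ?_⟩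
  · haveI := hi
    haveI : IsIso ((RC.complexObjects (rcOf π)).ι.map (frobHomC π X hc p)) := inferInstance
    exact (isIrreducibleHom_frobHom π hTE X hX p hp).1 (this : IsIso (frobHom π X p))
  · have h' : β.hom ≫ α.hom = frobHom π X p := congrArg (fun k => k.hom) h
    rcases (isIrreducibleHom_frobHom π hTE X hX p hp).2 β.hom α.hom h' with hα | hβ
    · haveI := hα; exact Or.inl (isIso_of_isIso_hom' α)
    · haveI := hβ; exact Or.inr (isIso_of_isIso_hom' β)

/-- Different prime degrees give non-isomorphic objects under `X` in `A[ℂ]`. [cite: MochizukiFrdII2008, Prop 3.5 (iv) p.34] -/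
theorem eq_of_under_iso (X : A π) (hc : RC.complexObjects (rcOf π) X) {p q : ℕ+} (hp : (p : ℕ).Prime)
    (hq : (q : ℕ).Prime) (e : Under.mk (frobHomC π X hc p) ≅ Under.mk (frobHomC π X hc q)) : p = q := by
  have w := Under.w e.hom
  have hd := congrArg (fun k => (C0.degFr k.hom.1.fst : ℕ)) w
  change (C0.degFr ((ArchFrd.frobHom π X.obj p) ≫ e.hom.right.hom.1).fst : ℕ) =
    (C0.degFr (ArchFrd.frobHom π X.obj q).fst : ℕ) at hd
  rw [CFP.comp_fst, C0.degFr_comp', PNat.mul_coe, degFr_frobHom, degFr_frobHom] at hd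
  exact PNat.coe_inj.1 ((Nat.prime_dvd_prime_iff_eq hp hq).1 (Dvd.intro _ hd))

/-- **An object of `A` with naively isotropic region is not an anchor of `A[ℂ]`** (`D` totally
epimorphic). [cite: MochizukiFrdII2008, Prop 3.5 (iv) p.34] -/
theorem not_isAnchor_complexPart_of_isotropic (hTE : IsTotallyEpimorphic D) (X : A π)
    (hc : RC.complexObjects (rcOf π) X) (hX : X.obj.fst.IsNaivelyIsotropic) :
    ¬ IsAnchor (⟨X, hc⟩ : RC.ComplexPart (rcOf π)) := by
  intro hfin
  let P : ℕ → ℕ+ := fun n => ⟨Nat.nth Nat.Prime n, (Nat.prime_nth_prime n).pos⟩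
  have hP : ∀ n, ((P n : ℕ+) : ℕ).Prime := fun n => Nat.prime_nth_prime n
  let g : ℕ → Quotient (isIsomorphicSetoid (Under (⟨X, hc⟩ : RC.ComplexPart (rcOf π)))) :=
    fun n => Quotient.mk _ (Under.mk (frobHomC π X hc (P n)))
  have hg : Function.Injective g := by
    intro m n hmn
    obtain ⟨e⟩ := Quotient.exact hmn
    have hPmn : P m = P n := eq_of_under_iso π X hc (hP m) (hP n) e
    have : Nat.nth Nat.Prime m = Nat.nth Nat.Prime n := congrArg (fun k : ℕ+ => (k : ℕ)) hPmn
    exact Nat.nth_injective Nat.infinite_setOf_prime this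
  refine Set.infinite_of_injective_forall_mem hg (fun n => ?_) hfin
  exact ⟨Under.mk (frobHomC π X hc (P n)), isIrreducibleHom_frobHomC π hTE X hc hX (P n) (hP n), rfl⟩

/-! ### The hull in `A` and [FrdI] Remark 3.1.1 -/

/-- The hull arrow `B → B^istr` is an isometry. [cite: MochizukiFrdII2008, Ex 3.3 (iii) p.29] -/
theorem isIsometry_toIstr (B : C π) : PreFrobenioid.IsIsometry (C.toElem π) (ArchFrd.toIstr π B) := by
  have h : PreFrobenioid.IsIsometry C0.toElem (ArchFrd.toIstr π B).fst := by
    rw [A0.isIsometry_iff_norm_mul_tip_pow]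
    change ‖((1 : ℂˣ) : ℂ)‖ * B.fst.tip ^ ((1 : ℕ+) : ℕ) = B.fst.tip
    rw [Units.val_one, norm_one, one_mul, PNat.one_coe, pow_one]
  exact h

/-- The hull arrow in `A`. [cite: MochizukiFrdII2008, Ex 3.3 (iii) p.29] -/
def toIstr (B : A π) : B ⟶ (⟨istrObj π B.obj⟩ : A π) := ⟨ArchFrd.toIstr π B.obj, isIsometry_toIstr π B.obj⟩

/-- The hull arrow of `A` is a monomorphism. [cite: MochizukiFrdI2008, Def. 1.3(v)] -/
theorem mono_toIstr (B : A π) : Mono (toIstr π B) := by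
  haveI := ArchFrd.mono_toIstr π B.obj
  exact ⟨fun f g h => WideSubcategory.hom_ext _
    ((cancel_mono (ArchFrd.toIstr π B.obj)).1 (congrArg (fun k => k.1) h))⟩

/-- The universal arrow `B^istr → X` of an isometry into a naively isotropic `X` is an isometry.
[cite: MochizukiFrdII2008, Ex 3.3 (iii) p.29] -/
theorem isIsometry_istrDesc {B X : A π} (f : B ⟶ X) (hX : X.obj.fst.IsNaivelyIsotropic) :
    PreFrobenioid.IsIsometry (C.toElem π) (ArchFrd.istrDesc π f.1 hX) := by
  have hf : PreFrobenioid.IsIsometry C0.toElem f.1.fst := f.2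
  have h : PreFrobenioid.IsIsometry C0.toElem (ArchFrd.istrDesc π f.1 hX).fst := by
    rw [A0.isIsometry_iff_norm_mul_tip_pow] at hf ⊢; exact hf
  exact h

/-- The universal arrow in `A`. [cite: MochizukiFrdII2008, Ex 3.3 (iii) p.29] -/
def istrDesc {B X : A π} (f : B ⟶ X) (hX : X.obj.fst.IsNaivelyIsotropic) : (⟨istrObj π B.obj⟩ : A π) ⟶ X :=
  ⟨ArchFrd.istrDesc π f.1 hX, isIsometry_istrDesc π f hX⟩

/-- `B → B^istr → X = f` in `A`. [cite: MochizukiFrdII2008, Ex 3.3 (iii) p.29] -/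
theorem toIstr_istrDesc {B X : A π} (f : B ⟶ X) (hX : X.obj.fst.IsNaivelyIsotropic) :
    toIstr π B ≫ istrDesc π f hX = f :=
  WideSubcategory.hom_ext _ (ArchFrd.toIstr_istrDesc π f.1 hX)

/-- `γ ↦ γ^istr : Aut_A(B) → Aut_A(B^istr)` via the isotropification functor of `A`.
[cite: MochizukiFrdII2008, Ex 3.3 (iii) p.29] -/
def istrAutHom (B : A π) : Aut B →* Aut ((istrEndo π).obj B) where
  toFun γ := (istrEndo π).mapIso γ
  map_one' := (istrEndo π).mapIso_refl B
  map_mul' γ δ := (istrEndo π).mapIso_trans δ γ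

/-- `γ ↦ γ^istr` is injective on `Aut_A(B)`. [cite: MochizukiFrdII2008, Ex 3.3 (iii) p.29] -/
theorem istrAutHom_injective (B : A π) : Function.Injective (istrAutHom π B) := by
  intro γ δ h
  have h1 : istrMap π γ.hom.1 = istrMap π δ.hom.1 := by
    have e := congrArg (fun k : Aut ((istrEndo π).obj B) => k.hom.1) h
    exact e
  have hfst := congrArg CFP.Hom.fst h1
  have hsnd' := congrArg CFP.Hom.snd h1
  have hsnd : γ.hom.1.snd = δ.hom.1.snd := hsnd'
  have hb := congrArg C0.Hom.base hfst
  have hd := congrArg C0.Hom.degFr hfst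
  have hs := congrArg C0.Hom.scalar hfst
  apply Iso.ext
  exact WideSubcategory.hom_ext _ (CFP.hom_ext (C0.hom_ext hb hd hs) hsnd)

/-- Compatibility with the hull arrow in `A`. [cite: MochizukiFrdII2008, Ex 3.3 (iii) p.29] -/
theorem toIstr_naturality_aut (B : A π) (γ : Aut B) :
    γ.hom ≫ toIstr π B = toIstr π B ≫ (istrAutHom π B γ).hom :=
  WideSubcategory.hom_ext _ (ArchFrd.toIstr_naturality π γ.hom.1)

/-- **[FrdI] Rmk. 3.1.1 in `A`**: a mono-minimal categorical quotient `B → X` of `A` with `X` naively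
isotropic has `B` naively isotropic. [cite: MochizukiFrdII2008, Prop 3.5 (iv) p.34] -/
theorem isNaivelyIsotropic_of_monoMinimalQuotient {B X : A π} (G : Subgroup (Aut B)) (f : B ⟶ X)
    (hf : IsMonoMinimalQuotient G f) (hX : X.obj.fst.IsNaivelyIsotropic) : B.obj.fst.IsNaivelyIsotropic := by
  haveI : Mono (toIstr π B) := mono_toIstr π B
  haveI : IsIso (toIstr π B) :=
    hf.2 (toIstr π B) (istrDesc π f hX) (toIstr_istrDesc π f hX) inferInstance
      ⟨G.map (istrAutHom π B), G.equivMapOfInjective _ (istrAutHom_injective π B), fun γ => by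
        rw [Subgroup.coe_equivMapOfInjective_apply]; exact toIstr_naturality_aut π B γ⟩
  haveI : IsIso (toIstr π B).1 := inferInstanceAs (IsIso ((A.ι π).map (toIstr π B)))
  exact C0.isNaivelyIsotropic_of_hom (inv (toIstr π B).1).fst (C0.isNaivelyIsotropic_isotropify B.obj.fst)

/-! ### Proposition 3.5 (iv) for `A` -/

/-- **Proposition 3.5 (iv) for the angular Frobenioid `A`** (PROVED, for `D` connected and totally
epimorphic as in Example 3.3): `A` is not of RC-iso-subanchor type.
[cite: MochizukiFrdII2008, Prop 3.5 (iv) p.34] -/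
theorem prop35iv (hD : IsGraphConnected D) (hTE : IsTotallyEpimorphic D) : Prop35iv_A π := by
  intro _ hA
  obtain ⟨d₀⟩ := hD.nonempty
  obtain ⟨_, _, _, ⟨B', ⟨hc', _⟩, _⟩, _⟩ := hA.isRCIsoSubanchor ⟨unitObjOver π d₀⟩
  obtain ⟨B₂, G₂, f₂, ⟨B₃, ⟨hc₃, hanch₃⟩, ⟨g₂⟩⟩, hf₂⟩ := hA.isRCIsoSubanchor ⟨unitObjOver π B'.obj.snd⟩
  have hB₂ : B₂.obj.fst.IsNaivelyIsotropic :=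
    isNaivelyIsotropic_of_monoMinimalQuotient π G₂ f₂ hf₂ (AngularRegion.isIsotropic_isotropicOfTip 1)
  have hB₃ : B₃.obj.fst.IsNaivelyIsotropic := C0.isNaivelyIsotropic_of_hom g₂.1.fst hB₂
  exact not_isAnchor_complexPart_of_isotropic π hTE B₃ hc₃ hB₃ hanch₃

end A

/-- **Proposition 3.5 (iv) for `A`**, instance form. [cite: MochizukiFrdII2008, Prop 3.5 (iv) p.34] -/
theorem prop35iv_A (hD : IsGraphConnected D) (hTE : IsTotallyEpimorphic D) : Prop35iv_A π :=
  A.prop35iv π hD hTE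

end ArchFrd

end

end Literature.AlgebraicGeometry.Frobenioids
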